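import Literature.NumberTheory.EllipticCurves.NeronModelBaseChange
import Literature.RingTheory.DedekindDomain.PrimesContaining
import Mathlib.RingTheory.Localization.LocalizationLocalization
import HarnessLib

/-!
# Gluing Néron models over a Dedekind domain: reduction to one bad prime and two open pieces

This file continues the decomposition of Néron's existence theorem
(`Literature.NumberTheory.EllipticCurves.exists_isNeronModel`, via
`Literature.NumberTheory.EllipticCurves.NeronModelExistence`). Its gluing leaf
`exists_isNeronModel_of_away_of_atPrime` — *a group scheme `E / K` with Néron models over
`R[1/f]` and over the local rings `R_𝔭` at the finitely many maximal ideals `𝔭 ∋ f` of the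
Dedekind domain `R` has a Néron model over `R`* (Bosch–Lütkebohmert–Raynaud, *Néron Models*,
§1.4; Silverman, *Advanced Topics*, proof of Thm. IV.6.1, p. 340: "gluing this large piece to
the finitely many bad fibers produces a Néron model over all of `Spec R`"; Artin, *Néron Models*,
proof of Thm. (1.2), p. 228: "Clearly, we may assume `R` local") — is **proved** here
(`exists_isNeronModel_of_away_of_atPrime_of_unique_of_glue`) from two smaller named facts:

* `exists_isNeronModel_of_away_of_atPrime_of_unique` — the **one-bad-prime case**: if `𝔭` is
  the *only* maximal ideal containing `f ≠ 0`, Néron models over (the models of) `R[1/f]` and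
  `R_𝔭` give a Néron model over `R` (BLR §1.4: spread the local model out to an open
  neighbourhood of `𝔭` by limit arguments, glue with the model over `D(f)`, and check the Néron
  property locally);
* `exists_isNeronModel_of_away_of_away` — **gluing over two comaximal basic open sets**: if
  `(a, b) = R` and `E` has Néron models over (the models of) `R[1/a]` and `R[1/b]`, it has one
  over `R` (the Néron mapping property is local on the base, BLR §1.2; the two models agree over
  `R[1/ab]` by uniqueness, `NeronModelUniqueProofs`, and glue).

## The induction (proved here)

Write `B(f) = {𝔭 maximal : f ∈ 𝔭}` (`maximalIdealsContaining` of
`Literature.RingTheory.DedekindDomain.PrimesContaining`, finite for `f ≠ 0`). We prove by induction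
on `#B(f)`, for all Dedekind `R` with fraction field `K` at once: hypotheses "Néron models over
all models of `R[1/f]`" (`HasNeronModelAway`) and "over all models of `R_𝔭`, `𝔭 ∈ B(f)`"
(`HasNeronModelAtPrime`) give a Néron model over `R`.

* `B(f) = ∅`: `f` is a unit, `R` is itself a model of `R[1/f]`
  (`HasNeronModelAway.exists_of_maximalIdealsContaining_eq_empty`).
* `B(f) = {𝔭₁}`: the one-bad-prime fact.
* otherwise pick `𝔭₁ ≠ 𝔮₀` in `B(f)` and (`exists_add_eq_one_of_finite`: prime avoidance for the
  finite intersection `⋂_{𝔮 ∈ B(f) ∖ {𝔭₁}} 𝔮 ⊄ 𝔭₁`, then `𝔭₁ + (g₀) = R`) elements `g + h = 1`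
  with `g ∉ 𝔭₁`, `h ∈ 𝔭₁`, `g ∈ 𝔮` for all other `𝔮 ∈ B(f)`. Over any model `T` of `R[1/g]`
  the only maximal ideal containing `f` is `𝔭₁T` (contraction is injective on primes of a
  localization and lands in `B(f)` avoiding `g`), so the one-bad-prime fact applies to `T`; over
  any model `R''` of `R[1/h]`, `#B(f)` drops (`𝔭₁` disappears), so the induction hypothesis
  applies to `R''`. In both cases the hypotheses descend to the localization: models of `T[1/f]`
  are models of open subschemes of `Spec R[1/f]` (`HasNeronModelAway.localization_away`, using
  `IsNeronModel.pullback_specOfAlgebraMap` of `NeronModelBaseChange`), and the local rings of a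
  localization are local rings of `R` (`hasNeronModelAtPrime_localization_away`, Mathlib
  `IsLocalization.isLocalization_isLocalization_atPrime_isLocalization`). Finally the
  two-open-sets fact glues `D(g) ∪ D(h) = Spec R`.

## References

* S. Bosch, W. Lütkebohmert, M. Raynaud, *Néron Models*, Springer 1990, §1.2 (Def. 1, Prop. 2,
  Prop. 4: local nature), §1.4 (global Néron models from local data). [BLRNeronModels1990]
* J. H. Silverman, *Advanced Topics in the Arithmetic of Elliptic Curves*, GTM 151, 1994, proof of
  Thm. IV.6.1, p. 340 (lit: PDF p. 319). [SilvermanATAEC1994]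
* M. Artin, *Néron Models*, in Cornell–Silverman (eds.), *Arithmetic Geometry*, 1986, proof of
  Thm. (1.2), p. 228 (lit: PDF p. 299). [Artin1986NeronModels]
-/

noncomputable section

universe u

namespace Literature.NumberTheory.EllipticCurves

open AlgebraicGeometry CategoryTheory
open scoped CategoryTheory.Obj

/-! ### The two hypotheses and their behaviour under localization -/

section LocalizationTransfer

variable {R : Type u} [CommRing R] {K : Type u} [Field K] [Algebra R K]

variable (R K) in
/-- `HasNeronModelAway R K E f`: the `K`-group scheme `E` has a Néron model over every `R`-algebra
model `R'` of the localization `R[1/f]` mapping compatibly to `K` (the first hypothesis of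
`exists_isNeronModel_of_away_of_atPrime`, verbatim). [folklore] -/
def HasNeronModelAway (E : Over (Spec (.of K))) [GrpObj E] (f : R) : Prop :=
  ∀ (R' : Type u) [CommRing R'] [Algebra R R'] [IsLocalization.Away f R'] [Algebra R' K]
    [IsScalarTower R R' K], ∃ 𝒩 : Grp (Over (Spec (.of R'))), IsNeronModel R' K 𝒩.X E

variable (R K) in
/-- `HasNeronModelAtPrime R K E 𝔭`: the `K`-group scheme `E` has a Néron model over every
`R`-algebra model `R'` of the local ring `R_𝔭` mapping compatibly to `K` (the second hypothesis
of `exists_isNeronModel_of_away_of_atPrime`, verbatim). [folklore] -/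
def HasNeronModelAtPrime (E : Over (Spec (.of K))) [GrpObj E] (p : Ideal R) [p.IsPrime] : Prop :=
  ∀ (R' : Type u) [CommRing R'] [Algebra R R'] [IsLocalization.AtPrime R' p] [Algebra R' K]
    [IsScalarTower R R' K], ∃ 𝒩 : Grp (Over (Spec (.of R'))), IsNeronModel R' K 𝒩.X E

variable {E : Over (Spec (.of K))} [GrpObj E] {f : R}

/-- If `E` has Néron models over the models of `R[1/f]` (`f` non-zero in `K`), then it has a
Néron model over every `R`-algebra `T → K` in which `f` is a unit and with `Spec T → Spec R` an
open immersion: `T` is an `R[1/f]`-algebra and `Spec T → Spec R[1/f]` is an open immersion (left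
cancellation of open immersions), so the Néron model over `R[1/f]` restricts to `T`
(`IsNeronModel.pullback_specOfAlgebraMap`). [folklore] -/
theorem HasNeronModelAway.exists_of_isUnit (H : HasNeronModelAway R K E f)
    (hfK : IsUnit (algebraMap R K f)) (T : Type u) [CommRing T] [Algebra R T] [Algebra T K]
    [IsScalarTower R T K] (hfT : IsUnit (algebraMap R T f))
    [IsOpenImmersion (specOfAlgebraMap R T)] :
    ∃ 𝒩 : Grp (Over (Spec (.of T))), IsNeronModel T K 𝒩.X E := by
  let Rf := Localization.Away f
  letI : Algebra Rf K := (IsLocalization.Away.lift f hfK).toAlgebra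
  haveI : IsScalarTower R Rf K :=
    IsScalarTower.of_algebraMap_eq fun x => (IsLocalization.Away.lift_eq f hfK x).symm
  letI : Algebra Rf T := (IsLocalization.Away.lift f hfT).toAlgebra
  haveI : IsScalarTower R Rf T :=
    IsScalarTower.of_algebraMap_eq fun x => (IsLocalization.Away.lift_eq f hfT x).symm
  haveI : IsScalarTower Rf T K := by
    refine IsScalarTower.of_algebraMap_eq' ?_
    apply IsLocalization.ringHom_ext (Submonoid.powers f)
    rw [RingHom.comp_assoc, ← IsScalarTower.algebraMap_eq R Rf T, ← IsScalarTower.algebraMap_eq,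
      ← IsScalarTower.algebraMap_eq]
  haveI : IsOpenImmersion (specOfAlgebraMap R Rf) := IsOpenImmersion.of_isLocalization f
  haveI : IsOpenImmersion (specOfAlgebraMap Rf T ≫ specOfAlgebraMap R Rf) := by
    have : specOfAlgebraMap Rf T ≫ specOfAlgebraMap R Rf = specOfAlgebraMap R T := by
      simp only [specOfAlgebraMap, ← Spec.map_comp, ← CommRingCat.ofHom_comp,
        ← IsScalarTower.algebraMap_eq R Rf T]
    rw [this]; infer_instance
  haveI : IsOpenImmersion (specOfAlgebraMap Rf T) :=
    IsOpenImmersion.of_comp _ (specOfAlgebraMap R Rf)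
  exact exists_isNeronModel_of_isOpenImmersion E (H Rf)

/-- The hypothesis `HasNeronModelAway` descends to localizations: if `E` has Néron models over the
models of `R[1/f]`, then for any model `R''` of `R[1/x]` it has Néron models over the models of
`R''[1/f]` (these are `R`-algebras in which `f` is a unit, open in `Spec R`). [folklore] -/
theorem HasNeronModelAway.localization_away (H : HasNeronModelAway R K E f)
    (hfK : IsUnit (algebraMap R K f)) (x : R) (R'' : Type u) [CommRing R''] [Algebra R R'']
    [IsLocalization.Away x R''] [Algebra R'' K] [IsScalarTower R R'' K] :
    HasNeronModelAway R'' K E (algebraMap R R'' f) := by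
  intro T _ _ _ _ _
  letI : Algebra R T := ((algebraMap R'' T).comp (algebraMap R R'')).toAlgebra
  haveI : IsScalarTower R R'' T := IsScalarTower.of_algebraMap_eq' rfl
  haveI : IsScalarTower R T K := IsScalarTower.of_algebraMap_eq fun y => by
    rw [IsScalarTower.algebraMap_apply R R'' T, ← IsScalarTower.algebraMap_apply R'' T K,
      ← IsScalarTower.algebraMap_apply]
  have hfT : IsUnit (algebraMap R T f) := by
    rw [IsScalarTower.algebraMap_apply R R'' T]
    exact IsLocalization.Away.algebraMap_isUnit (algebraMap R R'' f)
  haveI : IsOpenImmersion (specOfAlgebraMap R R'') := IsOpenImmersion.of_isLocalization x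
  haveI : IsOpenImmersion (specOfAlgebraMap R'' T) :=
    IsOpenImmersion.of_isLocalization (algebraMap R R'' f)
  haveI : IsOpenImmersion (specOfAlgebraMap R T) := by
    have : specOfAlgebraMap R T = specOfAlgebraMap R'' T ≫ specOfAlgebraMap R R'' := by
      simp only [specOfAlgebraMap, ← Spec.map_comp, ← CommRingCat.ofHom_comp,
        ← IsScalarTower.algebraMap_eq R R'' T]
    rw [this]; infer_instance
  exact H.exists_of_isUnit hfK T hfT

/-- The hypothesis `HasNeronModelAtPrime` descends to localizations: the local ring of a model
`R''` of `R[1/x]` at a maximal ideal `P ∋ f` is the local ring of `R` at the contraction of `P`,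
a maximal ideal of the Dedekind domain `R` containing `f ≠ 0` (Mathlib
`IsLocalization.isLocalization_isLocalization_atPrime_isLocalization`). [folklore] -/
theorem hasNeronModelAtPrime_localization_away [IsDedekindDomain R]
    (HP : ∀ (p : Ideal R) [p.IsMaximal], f ∈ p → HasNeronModelAtPrime R K E p) (hf : f ≠ 0)
    (x : R) (R'' : Type u) [CommRing R''] [Algebra R R''] [IsLocalization.Away x R'']
    [Algebra R'' K] [IsScalarTower R R'' K] (P : Ideal R'') [P.IsMaximal]
    (hfP : algebraMap R R'' f ∈ P) : HasNeronModelAtPrime R'' K E P := by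
  intro T _ _ _ _ _
  letI : Algebra R T := ((algebraMap R'' T).comp (algebraMap R R'')).toAlgebra
  haveI : IsScalarTower R R'' T := IsScalarTower.of_algebraMap_eq' rfl
  haveI : IsScalarTower R T K := IsScalarTower.of_algebraMap_eq fun y => by
    rw [IsScalarTower.algebraMap_apply R R'' T, ← IsScalarTower.algebraMap_apply R'' T K,
      ← IsScalarTower.algebraMap_apply]
  haveI : IsLocalization.AtPrime T (P.comap (algebraMap R R'')) :=
    IsLocalization.isLocalization_isLocalization_atPrime_isLocalization (Submonoid.powers x) T P
  have hfp : f ∈ P.comap (algebraMap R R'') := Ideal.mem_comap.mpr hfP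
  haveI : (P.comap (algebraMap R R'')).IsMaximal :=
    Ideal.IsPrime.isMaximal inferInstance fun h => hf (by simpa [h] using hfp)
  exact HP (P.comap (algebraMap R R'')) hfp T

end LocalizationTransfer

/-! ### The two named facts -/

section Facts

/-- **Gluing Néron models over two comaximal basic open sets** (the Néron mapping property is
local on the base: Bosch–Lütkebohmert–Raynaud, *Néron Models*, §1.2, Prop. 4 and §1.4; the
gluing sentence of Silverman, *ATAEC*, proof of Thm. IV.6.1, p. 340). Let `R` be a Dedekind
domain with fraction field `K`, `E` a group scheme over `K`, and `a, b ∈ R` with `(a, b) = R`,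
i.e. `Spec R = D(a) ∪ D(b)`. If `E` has a Néron model over (every model of) `R[1/a]` and over
(every model of) `R[1/b]`, then `E` has a Néron model over `R`. (Proof sketch — the sources state
the local nature / the gluing without spelling it out: the two models restrict to Néron models
over `R[1/ab]` (`IsNeronModel.pullback_away`), which are isomorphic as group schemes by uniqueness
(`IsNeronModel.exists_iso_of_isNeronModel_holds`); glue the schemes along this isomorphism; the
result is a Néron model because the Néron property is local on the base
(`IsSchematicNeronModel.of_localization_away` of `NeronModelLocal`), and its group structure is
automatic (`IsSchematicNeronModel.exists_grp`).) Silverman's sentence is for elliptic curves; the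
statement for group schemes is BLR's local nature of Néron models.
[cite: BLRNeronModels1990, §1.2 (local nature of the Néron property) and §1.4]
[cite: SilvermanATAEC1994, proof of Thm. IV.6.1 (p. 340)] -/
def exists_isNeronModel_of_away_of_away : Prop :=
  ∀ (R : Type u) [CommRing R] [IsDedekindDomain R] (K : Type u) [Field K] [Algebra R K]
    [IsFractionRing R K] (E : Over (Spec (.of K))) [GrpObj E] (a b : R),
    Ideal.span {a, b} = ⊤ → HasNeronModelAway R K E a → HasNeronModelAway R K E b →
    ∃ 𝒩 : Grp (Over (Spec (.of R))), IsNeronModel R K 𝒩.X E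

/-- **Gluing a local Néron model at a single bad prime** (Bosch–Lütkebohmert–Raynaud, *Néron
Models*, §1.4, the one-point case of the passage from local to global Néron models over a
Dedekind scheme; Silverman, *ATAEC*, proof of Thm. IV.6.1, p. 340). Let `R` be a Dedekind domain
with fraction field `K`, `E` a group scheme over `K`, `0 ≠ f ∈ R` and `𝔭` the **only** maximal
ideal of `R` containing `f` (so `Spec R = D(f) ∪ {𝔭}`). If `E` has a Néron model over (every
model of) `R[1/f]` and over (every model of) the discrete valuation ring `R_𝔭`, then `E` has a
Néron model over `R`. (Proof sketch, after BLR §1.4: the model over `R_𝔭` is of finite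
presentation, hence
spreads out to a smooth separated group scheme of finite type over some `R[1/g]`, `g ∉ 𝔭`
(EGA IV₃ 8.8.2, 8.10.5, IV₄ 17.7.8); after shrinking `D(g)` it is isomorphic over `R[1/fg]` to
the model over `R[1/f]` (both have generic fibre `E`; limit argument for isomorphisms); glue over
`D(f) ∪ D(g) = Spec R`; the result is a Néron model because the Néron property can be checked
over `R[1/f]` and over `R_𝔭` (BLR §1.2, Prop. 4).)
[cite: BLRNeronModels1990, §1.4 (local-to-global passage, one closed point)] -/
def exists_isNeronModel_of_away_of_atPrime_of_unique : Prop :=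
  ∀ (R : Type u) [CommRing R] [IsDedekindDomain R] (K : Type u) [Field K] [Algebra R K]
    [IsFractionRing R K] (E : Over (Spec (.of K))) [GrpObj E] (f : R) (p : Ideal R)
    [p.IsMaximal], f ≠ 0 → f ∈ p → (∀ q : Ideal R, q.IsMaximal → f ∈ q → q = p) →
    HasNeronModelAway R K E f → HasNeronModelAtPrime R K E p →
    ∃ 𝒩 : Grp (Over (Spec (.of R))), IsNeronModel R K 𝒩.X E

end Facts

/-! ### The induction on the number of bad primes -/

section Induction

open Literature.RingTheory.DedekindDomain

variable {R : Type u} [CommRing R] {K : Type u} [Field K] [Algebra R K]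
  {E : Over (Spec (.of K))} [GrpObj E] {f : R}

/-- If `f` is a unit, `R` is a model of `R[1/f]`, so `HasNeronModelAway R K E f` gives a Néron
model over `R` itself. [folklore] -/
theorem HasNeronModelAway.exists_of_isUnit_self (hu : IsUnit f) (HA : HasNeronModelAway R K E f) :
    ∃ 𝒩 : Grp (Over (Spec (.of R))), IsNeronModel R K 𝒩.X E := by
  haveI : IsLocalization.Away f R :=
    IsLocalization.away_of_isUnit_of_bijective R hu Function.bijective_id
  exact HA R

/-- If no maximal ideal contains `f`, then `f` is a unit and `exists_of_isUnit` applies. [folklore]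
-/
theorem HasNeronModelAway.exists_of_maximalIdealsContaining_eq_empty
    (hempty : maximalIdealsContaining R f = ∅) (HA : HasNeronModelAway R K E f) :
    ∃ 𝒩 : Grp (Over (Spec (.of R))), IsNeronModel R K 𝒩.X E :=
  HA.exists_of_isUnit_self (isUnit_of_maximalIdealsContaining_eq_empty hempty)

/-- **The gluing leaf of Néron's theorem from its one-prime case and two-open-sets gluing**
(BLR §1.4; Silverman, proof of Thm. IV.6.1, p. 340; Artin, proof of Thm. (1.2), p. 228): granted
`exists_isNeronModel_of_away_of_atPrime_of_unique` and `exists_isNeronModel_of_away_of_away`,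
the named fact `exists_isNeronModel_of_away_of_atPrime` of `NeronModelExistence` holds — a group
scheme over `K` with Néron models over `R[1/f]` (`f ≠ 0`) and over `R_𝔭` for every maximal
`𝔭 ∋ f` has a Néron model over the Dedekind domain `R`. Proof: induction on the number of
maximal ideals containing `f`, simultaneously for all Dedekind domains with fraction field `K`
(see the module docstring): no bad prime — `f` is a unit; one — the one-prime fact; more — split
`Spec R = D(g) ∪ D(h)` with `g + h = 1`, `D(g)` containing exactly one bad prime (one-prime fact
over each model of `R[1/g]`) and `D(h)` missing one (induction hypothesis over each model of
`R[1/h]`), and glue with the two-open-sets fact.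
[cite: SilvermanATAEC1994, proof of Thm. IV.6.1 (p. 340)] -/
theorem exists_isNeronModel_of_away_of_atPrime_of_unique_of_glue
    (h1 : exists_isNeronModel_of_away_of_atPrime_of_unique.{u})
    (h2 : exists_isNeronModel_of_away_of_away.{u}) :
    exists_isNeronModel_of_away_of_atPrime.{u} := by
  suffices key : ∀ (n : ℕ) (R : Type u) [CommRing R] [IsDedekindDomain R] (K : Type u) [Field K]
      [Algebra R K] [IsFractionRing R K] (E : Over (Spec (.of K))) [GrpObj E] (f : R), f ≠ 0 →
      (maximalIdealsContaining R f).ncard ≤ n → HasNeronModelAway R K E f →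
      (∀ (p : Ideal R) [p.IsMaximal], f ∈ p → HasNeronModelAtPrime R K E p) →
      ∃ 𝒩 : Grp (Over (Spec (.of R))), IsNeronModel R K 𝒩.X E by
    intro R _ _ K _ _ _ E _ f hf HA HP
    exact key _ R K E f hf le_rfl HA (fun p _ hp => HP p hp)
  intro n
  induction n with
  | zero =>
    intro R _ _ K _ _ _ E _ f hf hn HA HP
    exact HA.exists_of_maximalIdealsContaining_eq_empty
      ((Set.ncard_eq_zero (finite_maximalIdealsContaining hf)).mp (Nat.le_zero.mp hn))
  | succ n ih =>
    intro R _ _ K _ _ _ E _ f hf hn HA HP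
    by_cases hempty : maximalIdealsContaining R f = ∅
    · exact HA.exists_of_maximalIdealsContaining_eq_empty hempty
    obtain ⟨p₁, hp₁⟩ := Set.nonempty_iff_ne_empty.mpr hempty
    haveI hp₁max : p₁.IsMaximal := hp₁.1
    have hfK : IsUnit (algebraMap R K f) :=
      isUnit_iff_ne_zero.mpr ((map_ne_zero_iff _ (IsFractionRing.injective R K)).mpr hf)
    by_cases huniq : ∀ q ∈ maximalIdealsContaining R f, q = p₁
    · -- exactly one bad prime: the one-prime fact over `R` itself
      exact h1 R K E f p₁ hf hp₁.2 (fun q hq hfq => huniq q ⟨hq, hfq⟩) HA (HP p₁ hp₁.2)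
    push Not at huniq
    obtain ⟨q₀, hq₀, hq₀ne⟩ := huniq
    obtain ⟨g, h, hgh, hgp₁, hhp₁, hgq⟩ :=
      exists_add_eq_one_of_finite (finite_maximalIdealsContaining hf) (fun q hq => hq.1) hp₁
    have hg0 : g ≠ 0 := by
      rintro rfl
      rw [zero_add] at hgh
      subst hgh
      exact hp₁max.ne_top ((Ideal.eq_top_iff_one _).mpr hhp₁)
    have hh0 : h ≠ 0 := by
      rintro rfl
      rw [add_zero] at hgh
      subst hgh
      exact hq₀.1.ne_top ((Ideal.eq_top_iff_one _).mpr (hgq q₀ hq₀ hq₀ne))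
    refine h2 R K E g h (span_pair_eq_top_of_add_eq_one hgh) ?_ ?_
    · -- over the models `T` of `R[1/g]`: `𝔭₁ T` is the only bad prime, use the one-prime fact
      intro T _ _ _ _ _
      have hgle := powers_le_nonZeroDivisors_of_noZeroDivisors hg0
      haveI : IsDomain T :=
        IsLocalization.isDomain_of_le_nonZeroDivisors (M := Submonoid.powers g) T hgle
      haveI : IsDedekindDomain T := IsLocalization.isDedekindDomain R hgle T
      haveI : IsFractionRing T K :=
        IsFractionRing.isFractionRing_of_isDomain_of_isLocalization (Submonoid.powers g) T K
      have hfT : algebraMap R T f ≠ 0 :=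
        (map_ne_zero_iff _ (IsLocalization.injective T hgle)).mpr hf
      have hdisj : Disjoint (Submonoid.powers g : Set R) (p₁ : Set R) :=
        (Ideal.disjoint_powers_iff_notMem_of_isPrime (I := p₁) g).mpr hgp₁
      haveI hP₁ : (p₁.map (algebraMap R T)).IsPrime :=
        IsLocalization.isPrime_of_isPrime_disjoint (Submonoid.powers g) T p₁ hp₁max.isPrime hdisj
      have hfP₁ : algebraMap R T f ∈ p₁.map (algebraMap R T) := Ideal.mem_map_of_mem _ hp₁.2
      haveI : (p₁.map (algebraMap R T)).IsMaximal :=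
        hP₁.isMaximal fun h0 => hfT (by simpa [h0] using hfP₁)
      refine h1 T K E (algebraMap R T f) (p₁.map (algebraMap R T)) hfT hfP₁ ?_
        (HA.localization_away hfK g T)
        (hasNeronModelAtPrime_localization_away HP hf g T _ hfP₁)
      intro Q hQ hfQ
      exact eq_map_of_mem_maximalIdealsContaining_localization hf g T hgq Q ⟨hQ, hfQ⟩
    · -- over the models `R''` of `R[1/h]`: `𝔭₁` is no longer a bad prime, use the induction
      intro R'' _ _ _ _ _
      have hhle := powers_le_nonZeroDivisors_of_noZeroDivisors hh0
      haveI : IsDomain R'' :=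
        IsLocalization.isDomain_of_le_nonZeroDivisors (M := Submonoid.powers h) R'' hhle
      haveI : IsDedekindDomain R'' := IsLocalization.isDedekindDomain R hhle R''
      haveI : IsFractionRing R'' K :=
        IsFractionRing.isFractionRing_of_isDomain_of_isLocalization (Submonoid.powers h) R'' K
      have hf'' : algebraMap R R'' f ≠ 0 :=
        (map_ne_zero_iff _ (IsLocalization.injective R'' hhle)).mpr hf
      have hcard := ncard_maximalIdealsContaining_localization_le hf h R'' hp₁ hhp₁
      exact ih R'' K E (algebraMap R R'' f) hf'' (by omega) (HA.localization_away hfK h R'')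
        (fun P _ hP => hasNeronModelAtPrime_localization_away HP hf h R'' P hP)

end Induction

end Literature.NumberTheory.EllipticCurves

end
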